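import Mathlib
import Summits.Ventures.DiscreteObjects.Mahler.UnimodularRootReciprocal

/-!
# Salem structure from the root count (venture `DiscreteObjects`, target L)

Cell `pub-namedobj`, seat `pub-namedobj-mahler` (gen 10). Framing: lottery ticket; floor = certified
bounds/negative ranges.

[McKee–Smyth, *Around the Unit Circle*, §5 / glossary "Salem polynomial", Exercise 12.15]: an
irreducible integer polynomial with exactly ONE complex root `α` outside the closed unit disc (all other
roots in `|z| ≤ 1`) and at least one root ON the unit circle is a Salem-type polynomial: it is reciprocal
of even degree, `α` is real, `α⁻¹` is a root, every other root is unimodular, and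
`M(P) = |lc(P)|·|α|`.  (For monic `P` and `α > 0` this says `α` is a Salem number with minimal
polynomial `P`; `lehmer_salem` (gen 9) is the instance `P = L`, Lehmer's polynomial.)

Kernel route: `P` is reciprocal by `reverse_eq_self_of_irreducible_of_unimodular_root` (Exercise
12.15), so its root multiset is closed under `β ↦ β⁻¹` as well as under complex conjugation; `ᾱ` is a
root outside the unit disc, hence `ᾱ = α`; a root `β` with `|β| < 1` has `β⁻¹` outside, hence
`β⁻¹ = α`.

* `mem_roots_inv_of_reverse_eq` — roots of a reciprocal integer polynomial are closed under inversion;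
* `salem_structure_of_irreducible` — the theorem.
-/

namespace Summit.Ventures.DiscreteObjects.Mahler

open Polynomial
open scoped ComplexConjugate

/-- Roots of a reciprocal (`P.reverse = P`) integer polynomial are closed under `β ↦ β⁻¹`. -/
theorem mem_roots_inv_of_reverse_eq {P : ℤ[X]} (hrev : P.reverse = P) (hP : P ≠ 0) {β : ℂ}
    (hβ : β ∈ (P.map (Int.castRingHom ℂ)).roots) : β⁻¹ ∈ (P.map (Int.castRingHom ℂ)).roots := by
  have hP' : P.map (Int.castRingHom ℂ) ≠ 0 := (Polynomial.map_ne_zero_iff (Int.castRingHom ℂ).injective_int).mpr hP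
  rw [mem_roots hP', IsRoot.def, eval_map] at hβ ⊢
  have hβ0 : β ≠ 0 := by
    rintro rfl
    -- `P(0) = 0` would make `X ∣ P`, but `P.reverse = P` has nonzero constant term `lc(P)`
    have h0 : P.coeff 0 = 0 := by
      have : ((P.coeff 0 : ℤ) : ℂ) = 0 := by rwa [eval₂_at_zero, eq_intCast] at hβ
      exact_mod_cast this
    have : P.leadingCoeff = 0 := by rw [← coeff_zero_reverse, hrev, h0]
    exact hP (leadingCoeff_eq_zero.mp this)
  letI : Invertible β := invertibleOfNonzero hβ0
  have h := (eval₂_reverse_eq_zero_iff (Int.castRingHom ℂ) β P).mpr hβ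
  rwa [hrev, invOf_eq_inv] at h

/-- Roots of an integer polynomial are closed under complex conjugation (multiset membership form). -/
theorem mem_roots_conj {P : ℤ[X]} (hP : P ≠ 0) {β : ℂ} (hβ : β ∈ (P.map (Int.castRingHom ℂ)).roots) :
    conj β ∈ (P.map (Int.castRingHom ℂ)).roots := by
  have hP' : P.map (Int.castRingHom ℂ) ≠ 0 := (Polynomial.map_ne_zero_iff (Int.castRingHom ℂ).injective_int).mpr hP
  rw [mem_roots hP', IsRoot.def, ← algebraMap_int_eq, eval_map_algebraMap] at hβ ⊢
  exact aeval_conj_eq_zero hβ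

/-- **Salem structure from the root count.**  Let `P ∈ ℤ[X]` be irreducible with a complex root `α`,
`|α| > 1`, such that every other root (the multiset of roots with one copy of `α` removed) lies in the
closed unit disc, and some root `ζ` lies on the unit circle.  Then `P` is reciprocal (`P.reverse = P`)
of even degree, `α` is real, `α⁻¹` is a root, every root other than `α, α⁻¹` is unimodular, and
`M(P) = |lc(P)| · |α|`. -/
theorem salem_structure_of_irreducible {P : ℤ[X]} (hirr : Irreducible P) {α ζ : ℂ}
    (hα : α ∈ (P.map (Int.castRingHom ℂ)).roots) (hα1 : 1 < ‖α‖)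
    (hothers : ∀ β ∈ ((P.map (Int.castRingHom ℂ)).roots).erase α, ‖β‖ ≤ 1)
    (hζ : ζ ∈ (P.map (Int.castRingHom ℂ)).roots) (hζ1 : ‖ζ‖ = 1) :
    P.reverse = P ∧ Even P.natDegree ∧ conj α = α ∧ α⁻¹ ∈ (P.map (Int.castRingHom ℂ)).roots ∧
      (∀ β ∈ (P.map (Int.castRingHom ℂ)).roots, β ≠ α → β ≠ α⁻¹ → ‖β‖ = 1) ∧
      intMahlerMeasure P = |(P.leadingCoeff : ℝ)| * ‖α‖ := by
  classical
  set R := (P.map (Int.castRingHom ℂ)).roots with hR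
  have hP : P ≠ 0 := hirr.ne_zero
  have hP' : P.map (Int.castRingHom ℂ) ≠ 0 :=
    (Polynomial.map_ne_zero_iff (Int.castRingHom ℂ).injective_int).mpr hP
  -- degree ≥ 2: `α ≠ ζ` are two roots
  have hαζ : α ≠ ζ := by
    intro h; rw [h, hζ1] at hα1; exact lt_irrefl _ hα1
  have hdeg : 2 ≤ P.natDegree := by
    have h1 : ({α, ζ} : Multiset ℂ) ≤ R := by
      rw [Multiset.le_iff_count]
      intro x
      rw [Multiset.insert_eq_cons, Multiset.count_cons, Multiset.count_singleton]
      by_cases hxα : x = α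
      · subst hxα
        rw [if_neg hαζ, if_pos rfl, zero_add]
        exact Multiset.one_le_count_iff_mem.mpr hα
      · rw [if_neg hxα, add_zero]
        by_cases hxζ : x = ζ
        · subst hxζ; rw [if_pos rfl]; exact Multiset.one_le_count_iff_mem.mpr hζ
        · rw [if_neg hxζ]; exact Nat.zero_le _
    have h2 := Multiset.card_le_card h1
    rw [Multiset.card_pair] at h2
    have h3 : Multiset.card R ≤ P.natDegree := by
      rw [hR, ← natDegree_map_eq_of_injective (Int.castRingHom ℂ).injective_int P]
      exact card_roots' _
    omega
  -- Exercise 12.15: `P` is reciprocal of even degree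
  have hζroot : aeval ζ P = 0 := by
    have := (mem_roots hP').mp hζ
    rwa [IsRoot.def, ← algebraMap_int_eq, eval_map_algebraMap] at this
  obtain ⟨hrev, heven⟩ := reverse_eq_self_of_irreducible_of_unimodular_root hirr hdeg hζ1 hζroot
  -- `α` is real
  have hconj : conj α = α := by
    by_contra hne
    have hmem : conj α ∈ R.erase α := (Multiset.mem_erase_of_ne hne).mpr (mem_roots_conj hP hα)
    have := hothers _ hmem
    rw [Complex.norm_conj] at this
    linarith
  -- `α⁻¹` is a root
  have hinv : α⁻¹ ∈ R := mem_roots_inv_of_reverse_eq hrev hP hα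
  -- the other roots are unimodular
  have hunit : ∀ β ∈ R, β ≠ α → β ≠ α⁻¹ → ‖β‖ = 1 := by
    intro β hβ hβα hβα'
    have hle : ‖β‖ ≤ 1 := hothers β ((Multiset.mem_erase_of_ne hβα).mpr hβ)
    by_contra hne
    have hlt : ‖β‖ < 1 := lt_of_le_of_ne hle hne
    have hβ0 : β ≠ 0 := by
      intro h
      have h0 := mem_roots_inv_of_reverse_eq hrev hP hβ
      -- `β = 0` ⇒ `0⁻¹ = 0` is a root; but then `α`-count: use `P(0) ≠ 0` via reverse
      rw [h, inv_zero, mem_roots hP', IsRoot.def, eval_map, eval₂_at_zero, eq_intCast] at h0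
      have hc0 : P.coeff 0 = 0 := by exact_mod_cast h0
      have : P.leadingCoeff = 0 := by rw [← coeff_zero_reverse, hrev, hc0]
      exact hP (leadingCoeff_eq_zero.mp this)
    have hβinv : β⁻¹ ∈ R := mem_roots_inv_of_reverse_eq hrev hP hβ
    have hβinvα : β⁻¹ ≠ α := by
      intro h; exact hβα' (by rw [← h, inv_inv])
    have h1 := hothers _ ((Multiset.mem_erase_of_ne hβinvα).mpr hβinv)
    rw [norm_inv] at h1
    have h2 : 1 < ‖β‖⁻¹ := one_lt_inv_iff₀.mpr ⟨norm_pos_iff.mpr hβ0, hlt⟩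
    linarith
  -- the Mahler measure
  have hM : intMahlerMeasure P = |(P.leadingCoeff : ℝ)| * ‖α‖ := by
    unfold intMahlerMeasure
    rw [mahlerMeasure_eq_leadingCoeff_mul_prod_roots,
      leadingCoeff_map_of_injective (Int.castRingHom ℂ).injective_int, eq_intCast, Complex.norm_intCast,
      ← hR, ← Multiset.cons_erase hα, Multiset.map_cons, Multiset.prod_cons, max_eq_right hα1.le]
    have hprod : ((R.erase α).map fun a => max 1 ‖a‖).prod = 1 := by
      rw [Multiset.map_congr rfl (fun β hβ => max_eq_left (hothers β hβ)), Multiset.map_const',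
        Multiset.prod_replicate, one_pow]
    rw [hprod, mul_one]
  exact ⟨hrev, heven, hconj, hinv, hunit, hM⟩

end Summit.Ventures.DiscreteObjects.Mahler
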